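import Literature.NumberTheory.GaloisRepresentations.LubinTateComparisonTraceTransportTwo
import Literature.NumberTheory.EllipticCurves.PAdicOneVariableTraceCriterionComplex
import HarnessLib

/-!
# `p = 2`: the measure of a trace-zero Coleman series is supported on `ℤ₂^×` — Coleman's `𝒮_{f'} h = 0`
# (units lane) plugged into the support criterion / socket of the measure side, through `ϑ` and `ℂ_F → ℂ_2`

Topic `NumberTheory/EllipticCurves`; namespace `Literature.NumberTheory.EllipticCurves`.

De Shalit, *Iwasawa theory of elliptic curves with complex multiplication* (1987), I.3.3 (7) ⟺ (7′) and
I.3.5 (11): the measure `μ_β` of a norm-coherent unit, read on `Ĝ_m` through `θ : Ĝ_m ≃ F_{f'}`, is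
supported on `ℤ_p^×`, and its moments are the Coates–Wiles derivatives.  This file composes

* the θ-TRANSPORT SEAM over the tree's `ℂ_F` (`LubinTateComparisonTraceTransportTwo.lean`:
  `𝒮_{f'} h₀ = 0 ⟹ Σ_{w²=1} Σ_m [S^m](h₀∘ϑ)(ζw − 1)^m = 0` at every `2`-power root of unity `ζ ∈ ℂ_F`), with
* the SUPPORT CRITERION and SOCKET over Mathlib's `ℂ_[p]` (`PAdicOneVariableTraceCriterionComplex.lean`:
  `PadicComplex.forall_invAmice₁_μ_eq_zero_of_nthRoots`,
  `PadicComplex.integral_restrictUnits_density_unitInv_pow_succ_eq_constantCoeff`),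

along ANY continuous ring map `θ : ℂ_F → ℂ_[2]` of norm `≤ 1` on `𝒪_{ℂ_F}` reaching the `2`-power roots of
unity (the canonical identification `CompletedAlgClosure ℚ_[2] ≃ ℂ_[2]` is such a `θ`; it is taken as a
hypothesis-object here, so that this file does not depend on its construction):

* ★ `sum_nthRootsFinset_tsum_map_eq_zero_of_forall` — the `ℂ_F`-side family of identities
  `Σ_{w²=1} Σ_m H_m (ζw−1)^m = 0` goes through `θ` (`HasSum.map`, `θ(±1) = ±1`);
* ★★★ `invAmice₁_μ_eq_zero_of_colemanTrace_eq_zero` — **`𝒮_{f'} h₀ = 0` (`h₀ ∈ 𝒪[F]⟦X⟧`) ⟹ the distribution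
  `D_{H'}` of `H' := θ(h₀ ∘ ϑ) ∈ ℂ_2⟦S⟧` VANISHES ON EVERY NON-UNIT CLASS of `ℤ/2^{N+1}`** (de Shalit (7′): `μ_β`
  lives on `ℤ₂^×`); the relative-coefficient twin is `PAdicOneVariableSupportOfColemanTraceRelTwo.lean`;
* ★★★ `integral_restrictUnits_density_unitInv_pow_succ_of_colemanTrace_eq_zero` — **THE SOCKET**:
  `∫ x^{k+1} d(restrictUnits (x⁻¹ · D_{H'})) = [S^0] D^k H'` for every `k` (de Shalit (11)).

Everything is proved; no named facts, no definitions, no instances, no `sorry`.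

## References

* [deShalit1987] E. de Shalit, *Iwasawa theory of elliptic curves with complex multiplication* (1987),
  I.3.3 (7)–(8) (p. 17–18), I.3.5 (11) (p. 18).
-/

noncomputable section

open MvPowerSeries Filter
open scoped PowerSeries.WithPiTopology Topology

namespace Literature.NumberTheory.EllipticCurves

section SupportOfColemanTraceTwo

open ValuativeRel IsLocalRing Field
open Literature.NumberTheory.GaloisRepresentations Literature.NumberTheory.GaloisRepresentations.IsNonarchimedeanLocalField
  Literature.NumberTheory.GaloisRepresentations.LubinTate Literature.NumberTheory.PAdicHodge

variable {F : Type} [Field F] [ValuativeRel F] [TopologicalSpace F] [IsNonarchimedeanLocalField F]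

attribute [local instance] ltNormUniformSpace ltNormIsUniformAddGroup rk1 nF nE fintypeResidueField

variable (hq : residueFieldCard F = 2) (h2 : (valuation F).IsUniformizer (((2 : ℕ) : 𝒪[F]) : F))
  {σ₀ : absoluteGaloisGroup F} (hσ₀ : IsAbsArithFrob σ₀) (u : 𝒪[F]ˣ)
  {ε : (maxUnramifiedCompletion F)ˣ}
  (hε : maxUnramifiedCompletion.galAut F σ₀ (ε : maxUnramifiedCompletion F) =
    algebraMap 𝒪[F] (maxUnramifiedCompletion F) (u : 𝒪[F]) * (ε : maxUnramifiedCompletion F))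
variable (θ : CompletedAlgClosure F →+* ℂ_[2]) (hθc : Continuous θ)
  (hθ1 : ∀ z : CBall F, ‖θ (z : CompletedAlgClosure F)‖ ≤ 1)
  (hθζ : ∀ ζ' : ℂ_[2], (∃ n : ℕ, ζ' ^ 2 ^ n = 1) →
    ∃ ζ : CompletedAlgClosure F, (∃ n : ℕ, ζ ^ 2 ^ n = 1) ∧ θ ζ = ζ')

/-! ### Transfer of the trace identities along `θ` -/

/-- The value `H(z)`, read in `ℂ_F`, as a `HasSum`. [cite: CasselsFrohlichANT1967, Ch. VI §3.2] -/
theorem hasSum_coeff_mul_pow_evS (H : PowerSeries (CBall F)) (z : (maxNilIdealC F).toIdeal) :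
    HasSum (fun m : ℕ ↦ ((PowerSeries.coeff m H : CBall F) : CompletedAlgClosure F) *
        ((z : CBall F) : CompletedAlgClosure F) ^ m)
      (((evS (maxNilIdealC F) z H : CBall F) : CompletedAlgClosure F)) := by
  have h1 := (PowerSeries.hasSum_aeval ((maxNilIdealC F).isTopologicallyNilpotent _ z.2) H).map
    (CBall F).subtype continuous_subtype_val
  convert h1 using 1
  · funext m
    simp only [Function.comp_apply, smul_eq_mul, Subring.subtype_apply, Subring.coe_mul, SubmonoidClass.coe_pow]
  · rfl

include hθc in
/-- The value `H(z)` pushed along `θ`: `Σ_m θ(H_m) θ(z)^m = θ(H(z))`. [cite: deShalit1987, I.3.3 (8) (p. 17)] -/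
theorem hasSum_map_coeff_mul_pow (H : PowerSeries (CBall F)) (z : (maxNilIdealC F).toIdeal) :
    HasSum (fun m : ℕ ↦ PowerSeries.coeff m (H.map (θ.comp (CBall F).subtype)) *
        (θ ((z : CBall F) : CompletedAlgClosure F)) ^ m)
      (θ ((evS (maxNilIdealC F) z H : CBall F) : CompletedAlgClosure F)) := by
  have h1 := (hasSum_coeff_mul_pow_evS H z).map θ hθc
  convert h1 using 1
  funext m
  simp only [Function.comp_apply, map_mul, map_pow, PowerSeries.coeff_map, RingHom.comp_apply,
    Subring.subtype_apply]

include h2 hθc hθζ in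
/-- ★ **Transfer along `θ : ℂ_F → ℂ_2`**: if `Σ_{w² = 1} Σ_m H_m (ζw − 1)^m = 0` in `ℂ_F` for every `2`-power
root of unity `ζ ∈ ℂ_F`, then `Σ_{w² = 1} Σ_m θ(H_m) (ζ'w − 1)^m = 0` in `ℂ_2` for every `2`-power root of
unity `ζ' ∈ ℂ_2` — the hypothesis `htrace` of the support criterion for `θH`. [cite: deShalit1987, I.3.3 (7′) (p. 17)] -/
theorem sum_nthRootsFinset_tsum_map_eq_zero_of_forall (H : PowerSeries (CBall F))
    (hH : ∀ (ζ : CompletedAlgClosure F) (n : ℕ), ζ ^ 2 ^ n = 1 →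
      ∑ w ∈ Polynomial.nthRootsFinset 2 (1 : CompletedAlgClosure F),
        ∑' m : ℕ, ((PowerSeries.coeff m H : CBall F) : CompletedAlgClosure F) * (ζ * w - 1) ^ m = 0)
    (ζ' : ℂ_[2]) (hζ' : ∃ n : ℕ, ζ' ^ 2 ^ n = 1) :
    ∑ w ∈ Polynomial.nthRootsFinset 2 (1 : ℂ_[2]),
      ∑' m : ℕ, PowerSeries.coeff m (H.map (θ.comp (CBall F).subtype)) * (ζ' * w - 1) ^ m = 0 := by
  classical
  obtain ⟨ζ, ⟨n, hζ⟩, rfl⟩ := hθζ ζ' hζ'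
  have h2C := two_ne_zero_C (F := F) h2
  have hne : (1 : CompletedAlgClosure F) ≠ -1 := fun h1 ↦ h2C (by linear_combination h1)
  have hne' : (1 : ℂ_[2]) ≠ -1 := fun h1 ↦ by
    have : (2 : ℂ_[2]) = 0 := by linear_combination h1
    exact two_ne_zero this
  -- the two points `ζ − 1`, `−ζ − 1` of `𝔪_ℂ`
  have hx : ‖ζ - 1‖ < 1 := norm_sub_one_lt_one_of_pow_two_pow_eq_one (norm_two_lt_one_C h2) hζ
  have hx' : ‖-ζ - 1‖ < 1 := by
    rw [show -ζ - 1 = (ζ - 1) + -(2 * ζ) by ring]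
    refine lt_of_le_of_lt (IsUltrametricDist.norm_add_le_max _ _) (max_lt hx ?_)
    have hζ1 : ‖ζ‖ ≤ 1 := by
      have h : ‖ζ‖ ^ 2 ^ n = 1 := by rw [← norm_pow, hζ, norm_one]
      exact (pow_eq_one_iff_of_nonneg (norm_nonneg ζ) (pow_ne_zero _ two_ne_zero)).mp h |>.le
    rw [norm_neg, norm_mul]
    calc ‖(2 : CompletedAlgClosure F)‖ * ‖ζ‖ ≤ ‖(2 : CompletedAlgClosure F)‖ * 1 := by gcongr
      _ < 1 := by rw [mul_one]; exact norm_two_lt_one_C h2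
  obtain ⟨x, hxe⟩ := exists_pt_coe_eq (F := F) hx
  obtain ⟨x', hx'e⟩ := exists_pt_coe_eq (F := F) hx'
  -- the `ℂ_F` identity at `ζ`, read through the points
  have key := hH ζ n hζ
  rw [nthRootsFinset_two_one, Finset.sum_pair hne, mul_one, mul_neg_one, ← hxe, ← hx'e,
    (hasSum_coeff_mul_pow_evS H x).tsum_eq, (hasSum_coeff_mul_pow_evS H x').tsum_eq] at key
  -- push along `θ`
  rw [nthRootsFinset_two_one, Finset.sum_pair hne', mul_one, mul_neg_one,
    show θ ζ - 1 = θ ((x : CBall F) : CompletedAlgClosure F) by rw [hxe, map_sub, map_one],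
    show -θ ζ - 1 = θ ((x' : CBall F) : CompletedAlgClosure F) by rw [hx'e, map_sub, map_neg, map_one],
    (hasSum_map_coeff_mul_pow θ hθc H x).tsum_eq, (hasSum_map_coeff_mul_pow θ hθc H x').tsum_eq, ← map_add, key,
    map_zero]

/-! ### The support criterion and the socket for `θ(h₀ ∘ ϑ)` -/

include hθ1 in
/-- The coefficients of `θH` are bounded by `1` (`H ∈ 𝒪_{ℂ_F}⟦S⟧`, `‖θ‖ ≤ 1` on `𝒪_{ℂ_F}`).
[cite: deShalit1987, I.3.3 (7) (p. 17)] -/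
theorem norm_coeff_map_le_one (H : PowerSeries (CBall F)) (m : ℕ) :
    ‖PowerSeries.coeff m (H.map (θ.comp (CBall F).subtype))‖ ≤ 1 := by
  rw [PowerSeries.coeff_map, RingHom.comp_apply]
  exact hθ1 _

include hq hθc hθζ in
/-- ★★★ **`𝒮_{f'} h₀ = 0 ⟹ D_{θ(h₀∘ϑ)}` vanishes on every non-unit class** (`h₀ ∈ 𝒪[F]⟦X⟧`, `f' = π'X + X²`,
`π' = 2u`; de Shalit's (7) ⟹ (7′): the measure `κμ_β` of a norm-coherent unit lives on `ℤ₂^×`).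
[cite: deShalit1987, I.3.3 (7)–(7′) (p. 17)] -/
theorem invAmice₁_μ_eq_zero_of_colemanTrace_eq_zero (n : ℕ) (h₀ : PowerSeries (LTCoeff F))
    (hS : colemanTrace (isUniformizer_unit_mul h2 u) n h₀ = 0) (N : ℕ) (b : ZMod (2 ^ (N + 1)))
    (hb : ¬IsUnit b) :
    (invAmice₁ 2 ((PowerSeries.subst ((compSeriesC h2 hσ₀ u hε).map (algebraMap (UnrCoeff F) (CBall F)))
        (h₀.map ((algebraMap (UnrCoeff F) (CBall F)).comp
          ((intToUnrCoeff F).comp (LTCoeff.of F).symm.toRingHom)))).map (θ.comp (CBall F).subtype))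
        (norm_coeff_map_le_one θ hθ1
          (PowerSeries.subst ((compSeriesC h2 hσ₀ u hε).map (algebraMap (UnrCoeff F) (CBall F)))
        (h₀.map ((algebraMap (UnrCoeff F) (CBall F)).comp
          ((intToUnrCoeff F).comp (LTCoeff.of F).symm.toRingHom)))))).μ (N + 1) b = 0 :=
  PadicComplex.forall_invAmice₁_μ_eq_zero_of_nthRoots (norm_coeff_map_le_one θ hθ1 _)
    (sum_nthRootsFinset_tsum_map_eq_zero_of_forall h2 θ hθc hθζ _ fun _ _ hζ ↦
      sum_nthRootsFinset_tsum_eq_zero_of_colemanTrace_eq_zero hq h2 hσ₀ u hε n h₀ hS hζ) N b hb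

include hq hθc hθζ in
/-- ★★★ **THE SOCKET from `𝒮_{f'} h₀ = 0`**: for `H' := θ(h₀ ∘ ϑ) ∈ ℂ_2⟦S⟧` and every `k`,
`∫ x^{k+1} d(restrictUnits (x⁻¹ · D_{H'})) = [S^0] D^k H'` (de Shalit's (11) for `μ_β♭`, the `𝔭`-unramified
range of the interpolation property). [cite: deShalit1987, I.3.5 (11) (p. 18), I.3.3 (7)–(8) (p. 17)] -/
theorem integral_restrictUnits_density_unitInv_pow_succ_of_colemanTrace_eq_zero (n : ℕ)
    (h₀ : PowerSeries (LTCoeff F)) (hS : colemanTrace (isUniformizer_unit_mul h2 u) n h₀ = 0) (k : ℕ) :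
    (restrictUnits ((invAmice₁ 2
        ((PowerSeries.subst ((compSeriesC h2 hσ₀ u hε).map (algebraMap (UnrCoeff F) (CBall F)))
          (h₀.map ((algebraMap (UnrCoeff F) (CBall F)).comp
            ((intToUnrCoeff F).comp (LTCoeff.of F).symm.toRingHom)))).map (θ.comp (CBall F).subtype))
        (norm_coeff_map_le_one θ hθ1
          (PowerSeries.subst ((compSeriesC h2 hσ₀ u hε).map (algebraMap (UnrCoeff F) (CBall F)))
        (h₀.map ((algebraMap (UnrCoeff F) (CBall F)).comp
          ((intToUnrCoeff F).comp (LTCoeff.of F).symm.toRingHom)))))).density (ProfiniteTower.padicInt_isUniform 2) (unitInv ℂ_[2])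
        uniformContinuous_unitInv norm_unitInv_le)).integral (fun x ↦ padicIntCast ℂ_[2] (x ^ (k + 1))) =
      PowerSeries.constantCoeff (mahlerD^[k]
        ((PowerSeries.subst ((compSeriesC h2 hσ₀ u hε).map (algebraMap (UnrCoeff F) (CBall F)))
          (h₀.map ((algebraMap (UnrCoeff F) (CBall F)).comp
            ((intToUnrCoeff F).comp (LTCoeff.of F).symm.toRingHom)))).map (θ.comp (CBall F).subtype))) :=
  PadicComplex.integral_restrictUnits_density_unitInv_pow_succ_eq_constantCoeff (norm_coeff_map_le_one θ hθ1 _)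
    (sum_nthRootsFinset_tsum_map_eq_zero_of_forall h2 θ hθc hθζ _ fun _ _ hζ ↦
      sum_nthRootsFinset_tsum_eq_zero_of_colemanTrace_eq_zero hq h2 hσ₀ u hε n h₀ hS hζ) k

end SupportOfColemanTraceTwo

end Literature.NumberTheory.EllipticCurves

end
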